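import Summits.Parity.GeneralizedHardyLittlewood.Theses.LiouvilleShiftedTables
import Literature.Barriers.Parity.SiegelZeroPrimePairs
import Literature.Barriers.Parity.SiegelZeroDichotomy
import Literature.Barriers.Parity.SiegelZeroDichotomyProofs
import Literature.NumberTheory.Sieve.ClusterComplexity
import Literature.NumberTheory.Sieve.LinearEquationsInPrimesProofs
import Literature.NumberTheory.Sieve.HardyLittlewoodProofs
import Literature.NumberTheory.Sieve.SingularSeriesPairProofs

/-!
# Disproof of `PairsToGHL` (crux stmt-Parity-9389) — findings of the standing disprover

`PairsToGHL := PairsHL → GeneralizedHardyLittlewood`, where `PairsHL` (inlined verbatim) is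
"for every `h ≥ 1`, `∑_{n ≤ N} Λ(n)Λ(n+h) − 𝔖({0,h})·N = o(N)`" and `GeneralizedHardyLittlewood`
is Green–Tao 2010, Conjecture 1.2 AS TYPED (`Literature.NumberTheory.Sieve.GeneralizedHardyLittlewood`:
all `d, t, L`; uniform over non-degenerate systems with `‖Ψ‖_N ≤ L` — constants up to `L·N` — and
convex `K ⊆ [-N,N]^d`; error `ε N^d`). Shared verbatim by routes LiouvilleShiftedTables,
RoughSemiprimeRigidity, LiouvilleMAD, HullDial (one ledger item; `Iff.rfl` between the route decls).

## Findings (everything below is kernel-checked unless marked NEAR-MISS)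

1. TRUTH-FUNCTIONAL (§1). `¬PairsToGHL ↔ PairsHL ∧ ¬GeneralizedHardyLittlewood` (`not_pairsToGHL_iff`):
   an UNCONDITIONAL kill = a proof of binary Hardy–Littlewood for every shift AND a refutation of
   Green–Tao Conj. 1.2. `GeneralizedHardyLittlewood → PairsToGHL` and `¬PairsHL → PairsToGHL`
   trivially (`pairsToGHL_truthTable`). No unconditional refutation is possible today; the crux is TRUE iff
   `PairsHL → GHL` is, i.e. (given that PairsHL is believed) iff GHL is.
2. JUNK-INSTANCE AUDIT of the typed conjecture (the only place an unconditional `¬GHL` could hide) —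
   NONE found: `t = 0` excluded (`1 ≤ t`); `K = ∅`/point/lower-dimensional convex sets carry lattice
   mass `O(N^{d-1})` against an ABSOLUTE error `εN^d`; identical forms, `ψ₂ = −ψ₁` and rational
   multiples are excluded by `IsNondegenerateSystem` (witnesses `(a,b) = (1,1)`, `(1,−1)`); forms with
   a common factor (`2n`, `3n`, `2n+2`) have `β_p = 0` at the bad prime and `O(log² N)` sums —
   consistent; negative values are killed on both sides (`Λ ∘ Int.toNat`, `β_∞` over the positive
   orthant); short/Maier-type `K` are harmless because the error is `εN^d`, not `o(vol K)`; `N = 0`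
   junk in `affLinSize` is behind `N ≥ N₀`. The one NON-artefact lever is SHIFT-UNIFORMITY
   (`|ψ_i(0)| ≤ L·N`, Green–Tao's own (1.1)), which is Landau–Siegel-hard — used in 3.
3. ILLUSORY-WORLD KILL (§3–§5, the substantive content; landing as
   `Theorems/PairsToGHL/Negative/{ShiftPairDictionary,UnboundedSiegelZeros}.lean`): modulo the
   vendored Matomäki–Merikoski Theorem 1.3 (`MatomakiMerikoski2023_pairCorrelation`),
   `UnboundedSiegelZeros → ¬GeneralizedHardyLittlewood`
   (`not_generalizedHardyLittlewood_of_unboundedSiegelZeros`; system `(n, n + 2q)`, `N = q^{10}`,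
   `L = 3`, `K = [-N,N]`: the exceptional zero DOUBLES the main term, `mm_correction_two_mul`), hence
   `UnboundedSiegelZeros → PairsHL → ¬PairsToGHL` (`pairsToGHL_false_of_unboundedSiegelZeros`) and
   `PairsToGHL ∧ PairsHL ⊢` bounded Siegel-zero quality (`siegelZeros_bounded_of_pairsToGHL`). On the
   way: the Green–Tao dictionary of `(n, n+h)` incl. **`∏_p β_p = goldbachSingularSeries h`**
   (`singularProduct_shiftPairSystem`) and `C₂ · m/φ(m) ≤ 𝔖(m)`. So: in the only consistent world in
   which anybody can refute the summit conjunct, the residual is FALSE exactly when the routes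
   SUCCEED (fixed-shift pairs are not obstructed by an exceptional zero — Matomäki–Merikoski
   Cor. 1.1 even proves them at exceptional scales); and any proof of the residual these routes can
   use is a Landau–Siegel-type theorem. In the GRH world the lever is void
   (`not_unboundedSiegelZeros_of_generalizedRiemannHypothesis`, tree).
3b. CONSISTENCY OF THE TWO ENDS (§7, positive direction, evidence only): `GeneralizedHardyLittlewood →
   PairsHL` shift by shift (`pairAsymptotic_of_ghl`) with `𝔖({0,h}) = ∏_p β_p((n,n+h))` for every `h ≠ 0`
   (`singularSeries_pair_eq_singularProduct`, partial products equal TERM BY TERM, so no convergence is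
   needed); hence `PairsToGHL ∧ PairsHL ↔ GeneralizedHardyLittlewood` (`pairsToGHL_and_pairsHL_iff_ghl`):
   the crux joined with the routes' target IS the summit conjunct, with no normalisation slack.
4. LOAD-BEARING HYPOTHESIS (§2). The crux has ONE hypothesis, `PairsHL`; dropping it leaves the summit
   conjunct itself (`PairsToGHLWithoutPairsHL := GeneralizedHardyLittlewood`), refutable only in the
   illusory world (3). Weakening/strengthening `PairsHL` inside what the routes produce (fixed
   shifts, slope 1, `d = 1`, `t = 2`) changes nothing in (3): the kill lives in the `t = 2`
   SHIFT-UNIFORM slice `h = 2q ≤ N`, which no fixed-shift statement reaches. A repaired residual that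
   (3) does NOT bite: `PairsHL → GHL_bdd` with constants `|ψ_i(0)| ≤ L` (not `L·N`) — but that is not
   the summit conjunct; or `PairsHL → ¬UnboundedSiegelZeros → GHL` (honest Siegel-conditional bridge);
   or `PairsHLUniform → GHL` with the hypothesis strengthened to shift-uniform pairs `h ≤ L·N` (TRUE in
   the illusory world, vacuously: there the uniform pairs statement itself fails at `h = 2q` by the
   same computation) — but no route here produces uniform pairs.
5. WHY IT RESISTS (for provers): even granting PairsHL, the consequent contains (a) prime `k`-tuples
   for all `k ≥ 3`, (b) other slopes at `t = 2` (`(n, 2n+1)` Sophie Germain, `(n, M − n)` Goldbach for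
   EVERY even `M ≤ LN`, no exceptional set), (c) shift-uniformity `h ≤ LN` (Siegel-complete by 3),
   (d) `d ≥ 2` infinite-complexity systems; none is implied by fixed-shift pair asymptotics by any
   known argument, and (a) is not even implied at the level of MODELS (pair statistics of a weight do
   not determine its triple statistics: block-`±1` perturbations `(a_k, b_k, a_k b_k)` of a
   Cramér–Granville weight keep every pair correlation and bias `∑ w(n)w(n+1)w(n+2)` — paper sketch in
   NOTES.md; not formalised). NEXT REGIMES for this seat: (i) a GRH-world analogue of 3 is impossible
   (GRH ⇒ ¬USZ), so 3 is the end of the conditional-refutation line; (ii) model-level non-implication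
   `∃ w ≥ 0, PairsHL[w] ∧ ¬Triples[w]` as a Lean barrier theorem (sizeable; needs a deterministic
   pseudorandom `±1` sequence with vanishing weighted pair correlations); a finite TOY certificate
   of the model-level non-implication is §8 (`toy_pairs_do_not_determine_triples`, `decide`).
[folklore]
-/

namespace Summit.Parity.GeneralizedHardyLittlewood.Cruxes.PairsToGHL.Disproof

open Finset Filter MeasureTheory
open scoped Topology ArithmeticFunction.vonMangoldt
open Literature.NumberTheory.Sieve Literature.Barriers.Parity
open Summit.Parity.GeneralizedHardyLittlewood.Theses

noncomputable section

/-! ## §1 Truth-functional structure of the crux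

The decl is shared VERBATIM (same signature, one ledger item stmt-Parity-9389) by the route files
RoughSemiprimeRigidity, LiouvilleMAD and HullDial (`Iff.rfl`, checked in the seat's scratch file
W.lean; those route modules are deliberately not imported here so that this workfile survives their
regeneration). -/

/-! ## §2 Load-bearing analysis: the single hypothesis `PairsHL` -/

/-- The crux with its only hypothesis `PairsHL` DROPPED: the summit conjunct itself. [folklore] -/
def PairsToGHLWithoutPairsHL : Prop := _root_.GeneralizedHardyLittlewood

/-- TRUTH TABLE of the crux (stated as one conjunction so that no component poses as a proof of the
item): it is TRUE in the GHL world; (vacuously) TRUE if fixed-shift Hardy–Littlewood pairs FAIL; under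
the routes' own target `PairsHL` it IS the summit conjunct; and dropping its only hypothesis can only
make it harder (`PairsToGHLWithoutPairsHL → PairsToGHL`; the dropped version is refuted in the
illusory world, §6, and nowhere else that is known). [folklore] -/
theorem pairsToGHL_truthTable :
    (_root_.GeneralizedHardyLittlewood → LiouvilleShiftedTables.PairsToGHL) ∧
    (¬ LiouvilleShiftedTables.PairsHL → LiouvilleShiftedTables.PairsToGHL) ∧
    (LiouvilleShiftedTables.PairsHL →
      (LiouvilleShiftedTables.PairsToGHL ↔ _root_.GeneralizedHardyLittlewood)) ∧
    (PairsToGHLWithoutPairsHL → LiouvilleShiftedTables.PairsToGHL) :=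
  ⟨fun h _ => h, fun h hP => absurd hP h, fun hP => ⟨fun h => h hP, fun h _ => h⟩, fun h _ => h⟩


/-! ## §3 The shift pair `(n, n + h)` in the Green–Tao dictionary -/

/-- `ψ₁(n) = n`. [cite: GreenTao2010, Example 1] -/
theorem shiftPairSystem_eval_zero (h : ℤ) (n : Fin 1 → ℤ) : (shiftPairSystem h 0).eval n = n 0 := by
  simp [shiftPairSystem, AffLinForm.eval]

/-- `ψ₂(n) = n + h`. [cite: GreenTao2010, Example 1] -/
theorem shiftPairSystem_eval_one (h : ℤ) (n : Fin 1 → ℤ) :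
    (shiftPairSystem h 1).eval n = n 0 + h := by
  simp [shiftPairSystem, AffLinForm.eval]

/-- `ψ₁(x) = x` on `ℝ`. [cite: GreenTao2010, Example 1] -/
theorem shiftPairSystem_realEval_zero (h : ℤ) (x : Fin 1 → ℝ) :
    (shiftPairSystem h 0).realEval x = x 0 := by
  simp [shiftPairSystem, AffLinForm.realEval]

/-- `ψ₂(x) = x + h` on `ℝ`. [cite: GreenTao2010, Example 1] -/
theorem shiftPairSystem_realEval_one (h : ℤ) (x : Fin 1 → ℝ) :
    (shiftPairSystem h 1).realEval x = x 0 + h := by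
  simp [shiftPairSystem, AffLinForm.realEval]

/-- `ψ₁ ≡ v (mod p)`. [cite: GreenTao2010, Example 1] -/
theorem shiftPairSystem_modEval_zero (h : ℤ) {p : ℕ} (v : Fin 1 → ZMod p) :
    (shiftPairSystem h 0).modEval p v = v 0 := by
  simp [shiftPairSystem, AffLinForm.modEval]

/-- `ψ₂ ≡ v + h (mod p)`. [cite: GreenTao2010, Example 1] -/
theorem shiftPairSystem_modEval_one (h : ℤ) {p : ℕ} (v : Fin 1 → ZMod p) :
    (shiftPairSystem h 1).modEval p v = v 0 + (h : ZMod p) := by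
  simp [shiftPairSystem, AffLinForm.modEval]

/-- The shift pair `(n, n + h)` with `h ≠ 0` satisfies Green–Tao's standing hypotheses.
[cite: GreenTao2010, Def. 1.1] -/
theorem isNondegenerateSystem_shiftPairSystem {h : ℤ} (hh : h ≠ 0) :
    IsNondegenerateSystem (shiftPairSystem h) := by
  refine ⟨fun i => ?_, fun i j hij a b hab => ?_⟩
  · fin_cases i <;> simp [shiftPairSystem]
  · have h0 := hab 0
    have h1 := hab 1
    fin_cases i <;> fin_cases j <;> simp_all [shiftPairSystem, AffLinForm.eval]

/-- `‖(n, n + h)‖_N = 1 + 1 + 0 + h/N ≤ 3` for `0 ≤ h ≤ N`. [cite: GreenTao2010, (1.1)] -/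
theorem affLinSize_shiftPairSystem_le {h N : ℕ} (hN : 0 < N) (hhN : h ≤ N) :
    affLinSize (shiftPairSystem (h : ℤ)) (N : ℝ) ≤ 3 := by
  have hN0 : (0 : ℝ) < N := by exact_mod_cast hN
  unfold affLinSize
  simp only [Fin.sum_univ_two, Fin.sum_univ_one, shiftPairSystem, Matrix.cons_val_zero,
    Matrix.cons_val_one, Int.cast_one, abs_one, Int.cast_zero, zero_div, abs_zero, zero_add,
    Int.cast_natCast]
  have h2 : |(h : ℝ) / N| ≤ 1 := by
    rw [abs_of_nonneg (by positivity), div_le_one hN0]; exact_mod_cast hhN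
  linarith

/-- Sums over the `d = 1` box `piFinset (fun _ : Fin 1 => s)` are sums over `s`. [folklore] -/
theorem sum_piFinset_fin_one_eq {α M : Type*} [AddCommMonoid M] (s : Finset α)
    (f : (Fin 1 → α) → M) :
    ∑ n ∈ Fintype.piFinset (fun _ : Fin 1 => s), f n = ∑ m ∈ s, f (fun _ => m) := by
  refine Finset.sum_nbij' (fun n => n 0) (fun m _ => m) (fun n hn => ?_) (fun m hm => ?_)
    (fun n _ => ?_) (fun m _ => rfl) (fun n _ => ?_)
  · exact Fintype.mem_piFinset.mp hn 0
  · exact Fintype.mem_piFinset.mpr fun _ => hm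
  · funext i; simp [Fin.fin_one_eq_zero i]
  · congr 1; funext i; simp [Fin.fin_one_eq_zero i]

/-- Over the full box `K = [-N, N]` the von Mangoldt sum (1.2) of `(n, n + h)` is
`∑_{n=1}^{N} Λ(n)Λ(n+h)` (terms with `n ≤ 0` vanish). [cite: GreenTao2010, (1.2)] -/
theorem vonMangoldtSum_shiftPairSystem (h N : ℕ) :
    vonMangoldtSum (shiftPairSystem (h : ℤ)) (realBox 1 N) N = ∑ n ∈ Icc 1 N, Λ n * Λ (n + h) := by
  classical
  unfold vonMangoldtSum
  rw [Finset.filter_true_of_mem]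
  swap
  · intro n hn
    have hn' := Fintype.mem_piFinset.mp hn
    simp only [realBox, Set.mem_Icc]
    refine ⟨fun j => ?_, fun j => ?_⟩
    · have := (Finset.mem_Icc.mp (hn' j)).1
      simp only [realPoint]; exact_mod_cast this
    · have := (Finset.mem_Icc.mp (hn' j)).2
      simp only [realPoint]; exact_mod_cast this
  unfold latticeBox
  rw [sum_piFinset_fin_one_eq]
  simp only [Fin.prod_univ_two, shiftPairSystem_eval_zero, shiftPairSystem_eval_one,
    intVonMangoldt]
  have hsub : Icc (1 : ℤ) N ⊆ Icc (-(N : ℤ)) N := Icc_subset_Icc (by omega) le_rfl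
  rw [← Finset.sum_subset hsub]
  swap
  · intro m hm hm'
    simp only [Finset.mem_Icc, not_and, not_le] at hm hm'
    have hm0 : m ≤ 0 := by
      by_contra h'
      exact absurd (hm' (by omega)) (by omega)
    rw [Int.toNat_eq_zero.mpr hm0, ArithmeticFunction.map_zero, zero_mul]
  refine Finset.sum_nbij' (fun m => m.toNat) (fun n => (n : ℤ)) (fun m hm => ?_) (fun n hn => ?_)
    (fun m hm => ?_) (fun n _ => by simp) (fun m hm => ?_)
  · simp only [Finset.mem_Icc] at hm ⊢; omega
  · simp only [Finset.mem_Icc] at hn ⊢; omega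
  · simp only [Finset.mem_Icc] at hm; omega
  · simp only [Finset.mem_Icc] at hm
    rw [show (m + (h : ℤ)).toNat = m.toNat + h by omega]

/-- `β_∞ = vol([-N, N] ∩ {x > 0} ∩ {x + h > 0}) = vol((0, N]) = N` for `(n, n + h)`, `h ≥ 0`.
[cite: GreenTao2010, (1.4)] -/
theorem archFactor_shiftPairSystem (h N : ℕ) :
    archFactor (shiftPairSystem (h : ℤ)) (realBox 1 N) = N := by
  unfold archFactor
  have hset : realBox 1 (N : ℝ) ∩ {x | ∀ i, 0 < (shiftPairSystem (h : ℤ) i).realEval x} =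
      Set.pi Set.univ (fun _ : Fin 1 => Set.Ioc (0 : ℝ) N) := by
    ext x
    simp only [realBox, Set.mem_inter_iff, Set.mem_Icc, Set.mem_setOf_eq, Set.mem_pi,
      Set.mem_univ, true_implies, Set.mem_Ioc, Fin.forall_fin_two, Fin.forall_fin_one,
      Pi.le_def, shiftPairSystem_realEval_zero, shiftPairSystem_realEval_one]
    have hh0 : (0 : ℝ) ≤ ((h : ℤ) : ℝ) := by exact_mod_cast (Int.natCast_nonneg h)
    constructor
    · rintro ⟨⟨-, h2⟩, h3, -⟩
      exact ⟨h3, h2⟩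
    · rintro ⟨h1, h2⟩
      have hN : (0 : ℝ) ≤ N := Nat.cast_nonneg N
      exact ⟨⟨by linarith, h2⟩, h1, by linarith⟩
  rw [hset, Real.volume_pi_Ioc_toReal]
  · simp
  · intro i
    exact Nat.cast_nonneg N

/-! ## §3b Local factors of `(n, n + h)` and `∏_p β_p = 𝔖(h)` -/

/-- `#{v mod p : v ≢ 0, v + h ≢ 0} = p - #{0, -h}`. [cite: GreenTao2010, Example 1] -/
theorem goodCount_shiftPairSystem (h : ℤ) (p : ℕ) [Fact p.Prime] :
    goodCount (shiftPairSystem h) p = p - #({0, -(h : ZMod p)} : Finset (ZMod p)) := by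
  classical
  unfold goodCount
  have hcard : #{v : Fin 1 → ZMod p | ∀ i, ¬ (shiftPairSystem h i).modEval p v = 0} =
      #{w : ZMod p | w ∉ ({0, -(h : ZMod p)} : Finset (ZMod p))} := by
    refine Finset.card_nbij' (fun v => v 0) (fun w _ => w) (fun v hv => ?_) (fun w hw => ?_)
      (fun v _ => ?_) (fun w _ => rfl)
    · simp only [Finset.coe_filter, Finset.mem_univ, true_and, Set.mem_setOf_eq,
        Fin.forall_fin_two, shiftPairSystem_modEval_zero, shiftPairSystem_modEval_one] at hv
      simp only [Finset.coe_filter, Finset.mem_univ, true_and, Set.mem_setOf_eq,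
        Finset.mem_insert, Finset.mem_singleton, not_or]
      exact ⟨hv.1, fun h' => hv.2 (by rw [h']; ring)⟩
    · simp only [Finset.coe_filter, Finset.mem_univ, true_and, Set.mem_setOf_eq,
        Finset.mem_insert, Finset.mem_singleton, not_or] at hw
      simp only [Finset.coe_filter, Finset.mem_univ, true_and, Set.mem_setOf_eq,
        Fin.forall_fin_two, shiftPairSystem_modEval_zero, shiftPairSystem_modEval_one]
      exact ⟨hw.1, fun h' => hw.2 (by linear_combination h')⟩
    · funext i; simp [Fin.fin_one_eq_zero i]
  rw [hcard, Finset.filter_not, Finset.filter_mem_eq_inter, Finset.univ_inter,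
    Finset.card_univ_sdiff, ZMod.card]

/-- For a prime `p ∣ h`: `β_p = p⁻¹ (p/(p-1))² (p - 1) = p/(p-1)` (in particular `β₂ = 2` for even
`h`). [cite: GreenTao2010, Example 1] -/
theorem localFactor_shiftPairSystem_of_dvd {h p : ℕ} (hp : p.Prime) (hdvd : p ∣ h) :
    localFactor (shiftPairSystem (h : ℤ)) p = (p : ℝ) / ((p : ℝ) - 1) := by
  haveI := Fact.mk hp
  have hzero : ((h : ℤ) : ZMod p) = 0 := by
    rw [Int.cast_natCast, ZMod.natCast_eq_zero_iff]; exact hdvd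
  rw [localFactor_prime, goodCount_shiftPairSystem, hzero, neg_zero,
    Finset.insert_eq_of_mem (Finset.mem_singleton_self _), Finset.card_singleton, pow_one,
    Nat.cast_sub hp.one_le]
  have hp2 : (2 : ℝ) ≤ p := by exact_mod_cast hp.two_le
  have hp1 : (p : ℝ) - 1 ≠ 0 := by linarith
  have hp0 : (p : ℝ) ≠ 0 := by linarith
  field_simp
  push_cast
  ring

/-- For a prime `p ∤ h`: `β_p = p⁻¹ (p/(p-1))² (p - 2) = 1 - 1/(p-1)²` (`= 0` at `p = 2`: the local
obstruction of an odd shift). [cite: GreenTao2010, Example 1] -/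
theorem localFactor_shiftPairSystem_of_not_dvd {h p : ℕ} (hp : p.Prime) (hndvd : ¬ p ∣ h) :
    localFactor (shiftPairSystem (h : ℤ)) p = 1 - 1 / ((p : ℝ) - 1) ^ 2 := by
  haveI := Fact.mk hp
  have hne : ((h : ℤ) : ZMod p) ≠ 0 := by
    rw [Int.cast_natCast, Ne, ZMod.natCast_eq_zero_iff]; exact hndvd
  have hne' : (0 : ZMod p) ≠ -((h : ℤ) : ZMod p) := fun h' => hne (neg_eq_zero.mp h'.symm)
  rw [localFactor_prime, goodCount_shiftPairSystem, Finset.card_pair hne', pow_one,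
    Nat.cast_sub hp.two_le]
  have hp2 : (2 : ℝ) ≤ p := by exact_mod_cast hp.two_le
  have hp1 : (p : ℝ) - 1 ≠ 0 := by linarith
  have hp0 : (p : ℝ) ≠ 0 := by linarith
  field_simp
  push_cast
  ring


/-- `p/(p-1) = (1 - 1/(p-1)²) · (p-1)/(p-2)` for `p > 2`. [folklore] -/
theorem div_pred_eq_mul {p : ℕ} (hp : 2 < p) :
    (p : ℝ) / ((p : ℝ) - 1) = (1 - 1 / ((p : ℝ) - 1) ^ 2) * (((p : ℝ) - 1) / ((p : ℝ) - 2)) := by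
  have hp3 : (3 : ℝ) ≤ p := by exact_mod_cast hp
  have hp1 : (p : ℝ) - 1 ≠ 0 := by linarith
  have hp2 : (p : ℝ) - 2 ≠ 0 := by linarith
  field_simp
  ring

/-- For even `h` and `x ≥ 2`: `∏_{p ≤ x} β_p = 2 · ∏_{2 < p ≤ x} (1 - 1/(p-1)²) · ∏_{2 < p ≤ x, p ∣ h} (p-1)/(p-2)`.
[cite: GreenTao2010, Example 1] -/
theorem singularProductPartial_shiftPairSystem {h x : ℕ} (hh : Even h) (hx : 2 ≤ x) :
    singularProductPartial (shiftPairSystem (h : ℤ)) x =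
      2 * twinPrimeConstPartial x *
        ∏ p ∈ (Nat.primesLE x).filter (fun p => 2 < p ∧ p ∣ h), (((p : ℝ) - 1) / ((p : ℝ) - 2)) := by
  rw [singularProductPartial, twinPrimeConstPartial]
  have h2 : 2 ∈ Nat.primesLE x := Nat.mem_primesLE.mpr ⟨hx, Nat.prime_two⟩
  rw [← Finset.mul_prod_erase _ _ h2,
    localFactor_shiftPairSystem_of_dvd Nat.prime_two (even_iff_two_dvd.mp hh)]
  have herase : (Nat.primesLE x).erase 2 = (Nat.primesLE x).filter (2 < ·) := by
    ext p
    simp only [Finset.mem_erase, Finset.mem_filter, Nat.mem_primesLE]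
    constructor
    · rintro ⟨hne, hpx, hp⟩
      exact ⟨⟨hpx, hp⟩, lt_of_le_of_ne hp.two_le (Ne.symm hne)⟩
    · rintro ⟨⟨hpx, hp⟩, h2p⟩
      exact ⟨h2p.ne', hpx, hp⟩
  have hβ2 : ((2 : ℕ) : ℝ) / (((2 : ℕ) : ℝ) - 1) = 2 := by norm_num
  have hpt : ∀ p ∈ (Nat.primesLE x).filter (2 < ·), localFactor (shiftPairSystem (h : ℤ)) p =
      (1 - 1 / ((p : ℝ) - 1) ^ 2) * (if p ∣ h then ((p : ℝ) - 1) / ((p : ℝ) - 2) else 1) := by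
    intro p hp
    obtain ⟨hp', h2p⟩ := Finset.mem_filter.mp hp
    have hpp : p.Prime := (Nat.mem_primesLE.mp hp').2
    by_cases hdvd : p ∣ h
    · rw [if_pos hdvd, localFactor_shiftPairSystem_of_dvd hpp hdvd, div_pred_eq_mul h2p]
    · rw [if_neg hdvd, localFactor_shiftPairSystem_of_not_dvd hpp hdvd, mul_one]
  rw [herase, hβ2, Finset.prod_congr rfl hpt, Finset.prod_mul_distrib, ← Finset.prod_filter,
    Finset.filter_filter, mul_assoc]

/-- For `x ≥ h ≥ 1` the primes `2 < p ≤ x` dividing `h` are the odd prime factors of `h`. [folklore] -/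
theorem primesLE_filter_dvd_eq {h x : ℕ} (h0 : h ≠ 0) (hx : h ≤ x) :
    (Nat.primesLE x).filter (fun p => 2 < p ∧ p ∣ h) = h.primeFactors.filter (2 < ·) := by
  ext p
  simp only [Finset.mem_filter, Nat.mem_primesLE, Nat.mem_primeFactors]
  constructor
  · rintro ⟨⟨-, hp⟩, h2p, hdvd⟩
    exact ⟨⟨hp, hdvd, h0⟩, h2p⟩
  · rintro ⟨⟨hp, hdvd, -⟩, h2p⟩
    exact ⟨⟨(Nat.le_of_dvd (Nat.pos_of_ne_zero h0) hdvd).trans hx, hp⟩, h2p, hdvd⟩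

/-- **`∏_p β_p = 𝔖(h)`**: for an even shift `h ≠ 0` the Green–Tao singular product of `(n, n + h)`
is the Hardy–Littlewood/Goldbach singular series `2C₂ ∏_{p ∣ h, p > 2} (p-1)/(p-2)`
(`goldbachSingularSeries h`): both ordered partial products converge
(`tendsto_singularProductPartial_holds`, `tendsto_twinPrimeConstPartial_div_two`) and they are
proportional from `x = max 2 h` on. [cite: GreenTao2010, Example 1 and (1.7)] -/
theorem singularProduct_shiftPairSystem {h : ℕ} (hh : Even h) (h0 : h ≠ 0) :
    singularProduct (shiftPairSystem (h : ℤ)) = goldbachSingularSeries h := by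
  have hnd : IsNondegenerateSystem (shiftPairSystem (h : ℤ)) :=
    isNondegenerateSystem_shiftPairSystem (by exact_mod_cast h0)
  have h1 : Tendsto (singularProductPartial (shiftPairSystem (h : ℤ))) atTop
      (𝓝 (singularProduct (shiftPairSystem (h : ℤ)))) :=
    tendsto_singularProductPartial_holds 1 2 _ hnd
  have hC : Tendsto twinPrimeConstPartial atTop (𝓝 twinPrimeConst) := by
    rw [twinPrimeConst_eq_singularSeries_pair_div_two]
    exact tendsto_twinPrimeConstPartial_div_two
  set F : ℝ := ∏ p ∈ h.primeFactors.filter (2 < ·), (((p : ℝ) - 1) / ((p : ℝ) - 2)) with hF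
  have h2 : Tendsto (singularProductPartial (shiftPairSystem (h : ℤ))) atTop
      (𝓝 (2 * twinPrimeConst * F)) := by
    have hlim : Tendsto (fun x => 2 * twinPrimeConstPartial x * F) atTop
        (𝓝 (2 * twinPrimeConst * F)) :=
      (hC.const_mul 2).mul_const F
    refine hlim.congr' ?_
    rw [EventuallyEq, eventually_atTop]
    refine ⟨max 2 h, fun x hx => ?_⟩
    rw [singularProductPartial_shiftPairSystem hh (le_of_max_le_left hx),
      primesLE_filter_dvd_eq h0 (le_of_max_le_right hx)]
  rw [goldbachSingularSeries_of_even h hh]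
  exact tendsto_nhds_unique h1 h2

/-! ## §4 `𝔖(h) ≥ C₂ · h/φ(h)` for even `h`, and the Matomäki–Merikoski factor at `h = 2q` -/

/-- `m/φ(m) = ∏_{p ∣ m} p/(p-1)` (from `φ(m) ∏_{p ∣ m} p = m ∏_{p ∣ m} (p - 1)`). [folklore] -/
theorem self_div_totient_eq_prod {m : ℕ} (hm : m ≠ 0) :
    (m : ℝ) / (Nat.totient m : ℝ) = ∏ p ∈ m.primeFactors, ((p : ℝ) / ((p : ℝ) - 1)) := by
  have key := Nat.totient_mul_prod_primeFactors m
  have hφ : (0 : ℝ) < Nat.totient m := by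
    exact_mod_cast Nat.totient_pos.mpr (Nat.pos_of_ne_zero hm)
  have hcast : (((∏ p ∈ m.primeFactors, (p - 1) : ℕ)) : ℝ) = ∏ p ∈ m.primeFactors, ((p : ℝ) - 1) := by
    rw [Nat.cast_prod]
    refine Finset.prod_congr rfl fun p hp => ?_
    rw [Nat.cast_sub (Nat.prime_of_mem_primeFactors hp).one_le, Nat.cast_one]
  have keyR : (Nat.totient m : ℝ) * ∏ p ∈ m.primeFactors, (p : ℝ) =
      (m : ℝ) * ∏ p ∈ m.primeFactors, ((p : ℝ) - 1) := by
    have := congrArg (Nat.cast : ℕ → ℝ) key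
    rw [Nat.cast_mul, Nat.cast_mul, hcast, Nat.cast_prod] at this
    exact this
  have hne : ∏ p ∈ m.primeFactors, ((p : ℝ) - 1) ≠ 0 := by
    refine Finset.prod_ne_zero_iff.mpr fun p hp => ?_
    have : (2 : ℝ) ≤ p := by exact_mod_cast (Nat.prime_of_mem_primeFactors hp).two_le
    linarith
  rw [Finset.prod_div_distrib, div_eq_div_iff hφ.ne' hne]
  linarith [keyR]

/-- For even `m ≠ 0`: `C₂ · m/φ(m) ≤ 𝔖(m) = 2C₂ ∏_{p ∣ m, p > 2} (p-1)/(p-2)`, since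
`m/φ(m) = 2 ∏_{p ∣ m, p > 2} p/(p-1)` and `p/(p-1) ≤ (p-1)/(p-2)`. [folklore] -/
theorem twinPrimeConst_mul_le_goldbachSingularSeries {m : ℕ} (hm : Even m) (h0 : m ≠ 0) :
    twinPrimeConst * ((m : ℝ) / (Nat.totient m : ℝ)) ≤ goldbachSingularSeries m := by
  rw [goldbachSingularSeries_of_even m hm, self_div_totient_eq_prod h0]
  have h2 : 2 ∈ m.primeFactors :=
    Nat.mem_primeFactors.mpr ⟨Nat.prime_two, even_iff_two_dvd.mp hm, h0⟩
  rw [← Finset.mul_prod_erase _ _ h2]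
  have herase : m.primeFactors.erase 2 = m.primeFactors.filter (2 < ·) := by
    ext p
    simp only [Finset.mem_erase, Finset.mem_filter, Nat.mem_primeFactors]
    constructor
    · rintro ⟨hne, hp, hdvd, hm0⟩
      exact ⟨⟨hp, hdvd, hm0⟩, lt_of_le_of_ne hp.two_le (Ne.symm hne)⟩
    · rintro ⟨⟨hp, hdvd, hm0⟩, h2p⟩
      exact ⟨h2p.ne', hp, hdvd, hm0⟩
  have hβ2 : ((2 : ℕ) : ℝ) / (((2 : ℕ) : ℝ) - 1) = 2 := by norm_num
  rw [herase, hβ2]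
  have hC : 0 < twinPrimeConst := twinPrimeConst_pos_holds
  have hle : ∏ p ∈ m.primeFactors.filter (2 < ·), ((p : ℝ) / ((p : ℝ) - 1)) ≤
      ∏ p ∈ m.primeFactors.filter (2 < ·), (((p : ℝ) - 1) / ((p : ℝ) - 2)) := by
    refine Finset.prod_le_prod (fun p hp => ?_) (fun p hp => ?_)
    · have : (3 : ℝ) ≤ p := by exact_mod_cast (Finset.mem_filter.mp hp).2
      exact div_nonneg (by linarith) (by linarith)
    · have hp3 : (3 : ℝ) ≤ p := by exact_mod_cast (Finset.mem_filter.mp hp).2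
      rw [div_le_div_iff₀ (by linarith) (by linarith)]
      nlinarith
  calc twinPrimeConst * (2 * ∏ p ∈ m.primeFactors.filter (2 < ·), ((p : ℝ) / ((p : ℝ) - 1)))
      = 2 * twinPrimeConst * ∏ p ∈ m.primeFactors.filter (2 < ·), ((p : ℝ) / ((p : ℝ) - 1)) := by
        ring
    _ ≤ 2 * twinPrimeConst * ∏ p ∈ m.primeFactors.filter (2 < ·), (((p : ℝ) - 1) / ((p : ℝ) - 2)) :=
        mul_le_mul_of_nonneg_left hle (by linarith)



/-- At the shift `h = 2q` the correction factor of Matomäki–Merikoski's Theorem 1.3 equals `+1`, so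
the main term DOUBLES: `φ(2^r) ∣ 2q` (`r = v₂(q)`), `2q/φ(2^r)` is even, and every prime factor of
`q' = q/2^r` divides `2q` (empty product). [cite: MatomakiMerikoski2023, Theorem 1.3] -/
theorem mm_correction_two_mul {q : ℕ} (hq : 0 < q) :
    (1 + if Nat.totient (2 ^ padicValNat 2 q) ∣ 2 * q then
        (-1 : ℝ) ^ (2 * q / Nat.totient (2 ^ padicValNat 2 q)) *
          ∏ p ∈ (q / 2 ^ padicValNat 2 q).primeFactors.filter (fun p => ¬ p ∣ 2 * q),
            (-1 : ℝ) / ((p : ℝ) - 2)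
      else 0) = 2 := by
  have _hq := hq
  set r := padicValNat 2 q with hr
  have ht : Nat.totient (2 ^ r) ∣ q := by
    rcases Nat.eq_zero_or_pos r with h0 | hpos
    · rw [h0, pow_zero, Nat.totient_one]; exact one_dvd q
    · rw [Nat.totient_prime_pow Nat.prime_two hpos]
      calc 2 ^ (r - 1) * (2 - 1) = 2 ^ (r - 1) := by norm_num
        _ ∣ 2 ^ r := pow_dvd_pow 2 (Nat.sub_le r 1)
        _ ∣ q := pow_padicValNat_dvd
  have hdvd : Nat.totient (2 ^ r) ∣ 2 * q := ht.trans (dvd_mul_left q 2)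
  have heven : Even (2 * q / Nat.totient (2 ^ r)) := by
    obtain ⟨m, hm⟩ := ht
    have htpos : 0 < Nat.totient (2 ^ r) := Nat.totient_pos.mpr (pow_pos two_pos r)
    refine ⟨m, ?_⟩
    rw [show 2 * q = Nat.totient (2 ^ r) * (m + m) by rw [hm]; ring, Nat.mul_div_cancel_left _ htpos]
  have hempty : (q / 2 ^ r).primeFactors.filter (fun p => ¬ p ∣ 2 * q) = ∅ := by
    refine Finset.filter_eq_empty_iff.mpr fun p hp hndvd => hndvd ?_
    exact ((Nat.dvd_of_mem_primeFactors hp).trans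
      (Nat.div_dvd_of_dvd pow_padicValNat_dvd)).trans (dvd_mul_left q 2)
  rw [if_pos hdvd, heven.neg_one_pow, hempty, Finset.prod_empty]
  norm_num

/-! ## §5 The illusory world refutes the uniform clause of `GeneralizedHardyLittlewood`, hence the crux given `PairsHL` -/

/-- **Siegel zeros of unbounded quality refute `GeneralizedHardyLittlewood`** (Green–Tao Conj. 1.2
as typed: uniform over systems of size `‖Ψ‖_N ≤ L`, i.e. constant terms up to `L·N`), modulo the
vendored theorem of Matomäki–Merikoski (`MatomakiMerikoski2023_pairCorrelation`, Theorem 1.3).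
Take the system `(n, n + 2q)` at `N = X = q^{10}`, `L = 3`, `K = [-N, N]`: in the dictionary
(`vonMangoldtSum_shiftPairSystem`, `archFactor_shiftPairSystem`, `singularProduct_shiftPairSystem`)
the conjecture predicts `∑_{n ≤ N} Λ(n)Λ(n+2q) = N𝔖(2q) + o(N)`, whereas a real zero
`1 - 1/(η log q)` of a primitive quadratic `L(s, χ)` mod `q` gives `2N𝔖(2q)` up to
`K (h/φ(h)) N (e^{-√(10 log η)} + e^{-(log N)^{1/2}} + 10 log⁶η/η)` (`mm_correction_two_mul`); with
`𝔖(2q) ≥ C₂ · 2q/φ(2q)` (`twinPrimeConst_mul_le_goldbachSingularSeries`) this is contradictory once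
`η` and `q` are large, which `UnboundedSiegelZeros` supplies. Hence every PROOF of the summit
conjunct bounds the quality of Siegel zeros at large conductors (the seed forwarded by the triage of
cards `siegel-hardness-uniform-ghl`, `summit-implies-landau-siegel`, `siegel-negative-bridge`).
[cite: MatomakiMerikoski2023, Theorem 1.3] [cite: GreenTao2010, Conj. 1.2] -/
theorem not_generalizedHardyLittlewood_of_unboundedSiegelZeros
    (hMM : MatomakiMerikoski2023_pairCorrelation) (hU : UnboundedSiegelZeros) :
    ¬ _root_.GeneralizedHardyLittlewood := by
  intro hG
  have hC₂ : 0 < twinPrimeConst := twinPrimeConst_pos_holds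
  obtain ⟨K, hK, hMM'⟩ := hMM 1 le_rfl (1 / 10) (by norm_num) 1 one_pos
  set δ : ℝ := twinPrimeConst / (12 * K) with hδ
  have hδpos : 0 < δ := by positivity
  -- the conjecture at `d = 1`, `t = 2`, `L = 3`, `ε = C₂/4`
  obtain ⟨N₀, hN₀⟩ := hG 1 2 3 le_rfl (by norm_num) (twinPrimeConst / 4) (by positivity)
  -- thresholds: the three error terms of Matomäki–Merikoski are eventually `≤ δ`
  have hT1 : ∀ᶠ η : ℝ in atTop, Real.exp (-1 * Real.sqrt (10 * Real.log η)) ≤ δ := by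
    have h1 : Tendsto (fun η : ℝ => Real.exp (-1 * Real.sqrt (10 * Real.log η))) atTop (𝓝 0) := by
      refine Real.tendsto_exp_atBot.comp ?_
      have : Tendsto (fun η : ℝ => Real.sqrt (10 * Real.log η)) atTop atTop :=
        Real.tendsto_sqrt_atTop.comp (Real.tendsto_log_atTop.const_mul_atTop (by norm_num))
      simpa using this.const_mul_atTop_of_neg (by norm_num : (-1 : ℝ) < 0)
    exact (h1.eventually (gt_mem_nhds hδpos)).mono fun _ h => h.le
  have hT2 : ∀ᶠ η : ℝ in atTop, 10 * Real.log η ^ (6 : ℕ) / η ≤ δ := by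
    have h1 : Tendsto (fun η : ℝ => 10 * Real.log η ^ (6 : ℕ) / η) atTop (𝓝 0) := by
      have := (Real.tendsto_pow_log_div_mul_add_atTop 1 0 6 one_ne_zero).const_mul 10
      rw [mul_zero] at this
      refine this.congr' (Eventually.of_forall fun η => ?_)
      simp only [one_mul, add_zero]
      ring
    exact (h1.eventually (gt_mem_nhds hδpos)).mono fun _ h => h.le
  have hT3 : ∀ᶠ X : ℝ in atTop, Real.exp (-1 * Real.log X ^ (3 / 5 - 1 / 10 : ℝ)) ≤ δ := by
    have h1 : Tendsto (fun X : ℝ => Real.exp (-1 * Real.log X ^ (3 / 5 - 1 / 10 : ℝ))) atTop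
        (𝓝 0) := by
      refine Real.tendsto_exp_atBot.comp ?_
      have : Tendsto (fun X : ℝ => Real.log X ^ (3 / 5 - 1 / 10 : ℝ)) atTop atTop :=
        (tendsto_rpow_atTop (by norm_num)).comp Real.tendsto_log_atTop
      simpa using this.const_mul_atTop_of_neg (by norm_num : (-1 : ℝ) < 0)
    exact (h1.eventually (gt_mem_nhds hδpos)).mono fun _ h => h.le
  obtain ⟨η₁, hη₁⟩ := eventually_atTop.mp (hT1.and hT2)
  obtain ⟨X₁, hX₁⟩ := eventually_atTop.mp hT3
  -- a Siegel zero of quality `η ≥ η₁` at a conductor `q ≥ max N₀ ⌈X₁⌉ 2`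
  obtain ⟨q, inst, χ, η, hq, hη, hprim, hquad, hη10, hL⟩ := hU η₁ (max N₀ (max ⌈X₁⌉₊ 2))
  have hqN₀ : N₀ ≤ q := le_of_max_le_left hq
  have hqX₁ : ⌈X₁⌉₊ ≤ q := le_of_max_le_left (le_of_max_le_right hq)
  have hq2 : 2 ≤ q := le_of_max_le_right (le_of_max_le_right hq)
  have hqpos : 0 < q := by omega
  set N : ℕ := q ^ 10 with hN
  have hNpos : 0 < N := pow_pos hqpos 10
  have hNr : (0 : ℝ) < N := by exact_mod_cast hNpos
  have hqN : q ≤ N := by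
    calc q = q ^ 1 := (pow_one q).symm
      _ ≤ q ^ 10 := Nat.pow_le_pow_right hqpos (by norm_num)
  have h2qN : 2 * q ≤ N := by
    calc 2 * q ≤ q * q := Nat.mul_le_mul_right q hq2
      _ = q ^ 2 := (sq q).symm
      _ ≤ q ^ 10 := Nat.pow_le_pow_right hqpos (by norm_num)
  set X : ℝ := (q : ℝ) ^ (10 : ℝ) with hXdef
  have hXN : X = (N : ℝ) := by
    rw [hXdef, hN, show (10 : ℝ) = ((10 : ℕ) : ℝ) by norm_num, Real.rpow_natCast, Nat.cast_pow]
  -- Matomäki–Merikoski at `h = 2q`, `V = 10`, `X = q^10`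
  have hA : ((2 * q : ℕ) : ℝ) ≤ 1 * X := by
    rw [hXN, one_mul]; exact_mod_cast h2qN
  have hM := hMM' q hq2 χ hprim hquad η hη10 hL 10 X le_rfl hXdef (2 * q) (by omega) hA
  rw [mm_correction_two_mul hqpos, hXN, Nat.floor_natCast] at hM
  -- the conjecture for `(n, n + 2q)` on `[-N, N]`
  have hnd : IsNondegenerateSystem (shiftPairSystem ((2 * q : ℕ) : ℤ)) :=
    isNondegenerateSystem_shiftPairSystem (by exact_mod_cast (show 2 * q ≠ 0 by omega))
  have hGq := hN₀ N (hqN₀.trans hqN) (shiftPairSystem ((2 * q : ℕ) : ℤ)) hnd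
    (affLinSize_shiftPairSystem_le hNpos h2qN) (realBox 1 N) (convex_Icc _ _) subset_rfl
  rw [vonMangoldtSum_shiftPairSystem, archFactor_shiftPairSystem,
    singularProduct_shiftPairSystem (even_two_mul q) (by omega), pow_one] at hGq
  -- bookkeeping
  set S : ℝ := ∑ n ∈ Icc 1 N, Λ n * Λ (n + 2 * q) with hS
  set 𝔖 : ℝ := goldbachSingularSeries (2 * q) with h𝔖
  set ρ : ℝ := ((2 * q : ℕ) : ℝ) / (Nat.totient (2 * q) : ℝ) with hρ
  have hρ1 : 1 ≤ ρ := by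
    have hφpos : (0 : ℝ) < (Nat.totient (2 * q) : ℝ) := by
      exact_mod_cast Nat.totient_pos.mpr (by omega)
    rw [hρ, le_div_iff₀ hφpos, one_mul]
    exact_mod_cast Nat.totient_le (2 * q)
  have hρ0 : 0 ≤ ρ := zero_le_one.trans hρ1
  have h𝔖ρ : twinPrimeConst * ρ ≤ 𝔖 :=
    twinPrimeConst_mul_le_goldbachSingularSeries (even_two_mul q) (by omega)
  obtain ⟨hE1, hE2⟩ := hη₁ η hη
  have hX₁N : X₁ ≤ (N : ℝ) :=
    (Nat.le_ceil X₁).trans (by exact_mod_cast hqX₁.trans hqN)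
  have hE3 := hX₁ (N : ℝ) hX₁N
  -- `N𝔖 ≤ |S - 2N𝔖| + |S - N𝔖| ≤ KρN·3δ + (C₂/4)N`
  have hKρN : 0 ≤ K * ρ * (N : ℝ) := mul_nonneg (mul_nonneg hK.le hρ0) hNr.le
  have key : (N : ℝ) * 𝔖 ≤ K * ρ * N * (3 * δ) + twinPrimeConst / 4 * N := by
    have hM' : |S - (N : ℝ) * 𝔖 * 2| ≤ K * ρ * N * (3 * δ) :=
      hM.trans (mul_le_mul_of_nonneg_left (by linarith) hKρN)
    have ha := neg_abs_le (S - (N : ℝ) * 𝔖 * 2)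
    have hb := le_abs_self (S - (N : ℝ) * 𝔖)
    linarith
  have h3δ : K * ρ * (N : ℝ) * (3 * δ) = (N : ℝ) * (twinPrimeConst * ρ / 4) := by
    rw [hδ]; field_simp; ring
  rw [h3δ] at key
  have hfin : 𝔖 ≤ twinPrimeConst * ρ / 4 + twinPrimeConst / 4 := by
    have h' : (N : ℝ) * 𝔖 ≤ (N : ℝ) * (twinPrimeConst * ρ / 4 + twinPrimeConst / 4) := by linarith
    exact le_of_mul_le_mul_left h' hNr
  have hCρ : twinPrimeConst * 1 ≤ twinPrimeConst * ρ := mul_le_mul_of_nonneg_left hρ1 hC₂.le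
  linarith



/-- The residual unfolds to `PairsHL → GeneralizedHardyLittlewood` (the route's own `PairsHL`,
inlined verbatim). [folklore] -/
theorem pairsToGHL_iff :
    LiouvilleShiftedTables.PairsToGHL ↔ (LiouvilleShiftedTables.PairsHL → _root_.GeneralizedHardyLittlewood) :=
  Iff.rfl

/-- What a refutation of the residual is: `¬PairsToGHL ↔ PairsHL ∧ ¬GeneralizedHardyLittlewood` — a
PROOF of Hardy–Littlewood pairs at every fixed shift together with a DISPROOF of Green–Tao's
Conjecture 1.2; in particular no unconditional kill exists short of settling both. [folklore] -/
theorem not_pairsToGHL_iff :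
    ¬ LiouvilleShiftedTables.PairsToGHL ↔
      (LiouvilleShiftedTables.PairsHL ∧ ¬ _root_.GeneralizedHardyLittlewood) := by
  rw [pairsToGHL_iff, Classical.not_imp]

/-- **The residual fails in the illusory world as soon as the routes succeed.** Modulo the vendored
Matomäki–Merikoski theorem: if Siegel zeros of unbounded quality exist (`UnboundedSiegelZeros`, the
standing hypothesis of Heath-Brown's dichotomy, consistent with every theorem in the tree) and the
routes deliver their target `PairsHL` (fixed-shift Hardy–Littlewood pairs, which an exceptional zero
does NOT obstruct — it even implies them at exceptional scales, Matomäki–Merikoski Cor. 1.1), then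
`PairsToGHL` is FALSE. Equivalently `PairsToGHL ∧ PairsHL ⊢ ¬UnboundedSiegelZeros`: any proof of the
residual usable by these routes is a Landau–Siegel-type theorem.
[cite: MatomakiMerikoski2023, Theorem 1.3 and Corollary 1.1] -/
theorem pairsToGHL_false_of_unboundedSiegelZeros (hMM : MatomakiMerikoski2023_pairCorrelation)
    (hU : UnboundedSiegelZeros) (hP : LiouvilleShiftedTables.PairsHL) :
    ¬ LiouvilleShiftedTables.PairsToGHL := fun h =>
  not_generalizedHardyLittlewood_of_unboundedSiegelZeros hMM hU (h hP)

/-- **Any proof of the residual, joined with the routes' target, bounds Siegel zeros**: from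
`PairsToGHL` and `PairsHL` (modulo Matomäki–Merikoski) there are `η₀`, `q₀` such that no primitive
quadratic character of conductor `q ≥ q₀` has a Siegel zero of quality `η ≥ η₀`
(`L(1 - 1/(η log q), χ) ≠ 0`). [cite: MatomakiMerikoski2023, Theorem 1.3] -/
theorem siegelZeros_bounded_of_pairsToGHL (hMM : MatomakiMerikoski2023_pairCorrelation)
    (hG : LiouvilleShiftedTables.PairsToGHL) (hP : LiouvilleShiftedTables.PairsHL) :
    ∃ η₀ : ℝ, ∃ q₀ : ℕ, ∀ (q : ℕ) [NeZero q] (χ : DirichletCharacter ℂ q) (η : ℝ),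
      q₀ ≤ q → IsSiegelZero χ η → η < η₀ := by
  have hnot : ¬ UnboundedSiegelZeros := fun hU =>
    pairsToGHL_false_of_unboundedSiegelZeros hMM hU hP hG
  unfold UnboundedSiegelZeros at hnot
  simp only [not_forall, not_exists, not_and] at hnot
  obtain ⟨η₀, q₀, hη⟩ := hnot
  refine ⟨η₀, q₀, fun q inst χ η hq hS => ?_⟩
  by_contra hlt
  exact hη q inst χ η hq (not_lt.mp hlt) hS

/-! ## §6 The load-bearing analysis completed by §5 -/

/-- "Any proof must use more than fixed-shift pairs, and must repel Siegel zeros": the crux with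
`PairsHL` dropped is FALSE in the illusory world (modulo Matomäki–Merikoski).
[cite: MatomakiMerikoski2023, Theorem 1.3] -/
theorem pairsToGHLWithoutPairsHL_false_of_unboundedSiegelZeros
    (hMM : MatomakiMerikoski2023_pairCorrelation) (hU : UnboundedSiegelZeros) :
    ¬ PairsToGHLWithoutPairsHL :=
  not_generalizedHardyLittlewood_of_unboundedSiegelZeros hMM hU

/-- In the illusory world the crux is EQUIVALENT to the failure of the routes' own target.
[cite: MatomakiMerikoski2023, Theorem 1.3] -/
theorem pairsToGHL_iff_not_pairsHL_of_unboundedSiegelZeros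
    (hMM : MatomakiMerikoski2023_pairCorrelation) (hU : UnboundedSiegelZeros) :
    LiouvilleShiftedTables.PairsToGHL ↔ ¬ LiouvilleShiftedTables.PairsHL :=
  ⟨fun h hP => not_generalizedHardyLittlewood_of_unboundedSiegelZeros hMM hU (h hP),
    fun h hP => absurd hP h⟩

/-- In the GRH world the lever of §5 is void: GRH refutes `UnboundedSiegelZeros` (tree), so no
Siegel-zero-based refutation of the crux can be made unconditional without refuting GRH. [folklore] -/
theorem lever_void_under_grh (h : Literature.NumberTheory.LFunctions.GeneralizedRiemannHypothesis) :
    ¬ UnboundedSiegelZeros :=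
  not_unboundedSiegelZeros_of_generalizedRiemannHypothesis h

/-! ## §7 Consistency of the two ends: `GeneralizedHardyLittlewood → PairsHL` (positive direction; evidence for provers, not a Theorems landing) -/

/-- `ν_{{0,h}}(p) = #{0, h mod p}`. [folklore] -/
theorem tupleResidueCount_pair (h : ℤ) (p : ℕ) :
    tupleResidueCount ({0, h} : Finset ℤ) p = #({0, (h : ZMod p)} : Finset (ZMod p)) := by
  classical
  unfold tupleResidueCount
  rw [Finset.image_insert, Finset.image_singleton, Int.cast_zero]

/-- Factor by factor, the Hardy–Littlewood Euler factor of `𝔖({0,h})` is Green–Tao's local factor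
`β_p` of `(n, n + h)` (`p` prime, `h ≠ 0`): `(1 - ν/p)(1 - 1/p)^{-2}` with `ν = 1` (`p ∣ h`:
`= p/(p-1)`) or `ν = 2` (`p ∤ h`: `= 1 - 1/(p-1)²`). [cite: GreenTao2010, Example 1] -/
theorem singularSeriesFactor_pair_eq_localFactor {h p : ℕ} (hh : h ≠ 0) (hp : p.Prime) :
    singularSeriesFactor ({0, (h : ℤ)} : Finset ℤ) p = localFactor (shiftPairSystem (h : ℤ)) p := by
  classical
  haveI := Fact.mk hp
  have hcard : ({0, (h : ℤ)} : Finset ℤ).card = 2 :=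
    Finset.card_pair (by exact_mod_cast hh.symm)
  have hp2 : (2 : ℝ) ≤ p := by exact_mod_cast hp.two_le
  have hp1 : (p : ℝ) - 1 ≠ 0 := by linarith
  have hp0 : (p : ℝ) ≠ 0 := by linarith
  rw [singularSeriesFactor, hcard, tupleResidueCount_pair, Int.cast_natCast]
  by_cases hdvd : p ∣ h
  · have hzero : ((h : ℕ) : ZMod p) = 0 := (ZMod.natCast_eq_zero_iff h p).mpr hdvd
    rw [hzero, Finset.insert_eq_of_mem (Finset.mem_singleton_self _), Finset.card_singleton,
      localFactor_shiftPairSystem_of_dvd hp hdvd]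
    field_simp
    ring
  · have hne : ((h : ℕ) : ZMod p) ≠ 0 := fun h' => hdvd ((ZMod.natCast_eq_zero_iff h p).mp h')
    rw [Finset.card_pair hne.symm, localFactor_shiftPairSystem_of_not_dvd hp hdvd]
    field_simp
    push_cast
    ring

/-- **`𝔖({0,h}) = ∏_p β_p((n, n+h))`** for every `h ≠ 0`: the ordered partial products coincide term by
term, hence so do their `limUnder`s (no convergence needed). [cite: GreenTao2010, Example 1 and (1.7)] -/
theorem singularSeries_pair_eq_singularProduct {h : ℕ} (hh : h ≠ 0) :
    singularSeries ({0, (h : ℤ)} : Finset ℤ) = singularProduct (shiftPairSystem (h : ℤ)) := by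
  unfold singularSeries singularProduct
  congr 1
  funext x
  unfold singularSeriesPartial singularProductPartial
  exact Finset.prod_congr rfl fun p hp =>
    singularSeriesFactor_pair_eq_localFactor hh (Nat.mem_primesLE.mp hp).2

/-- **Consistency of the crux's two ends: `GeneralizedHardyLittlewood → PairsHL`, shift by shift.** The hypothesis of
`PairsToGHL` is exactly the `d = 1`, `t = 2`, slope-1, fixed-shift slice of its conclusion, with
matching normalisations (`𝔖({0,h}) = ∏_p β_p`, `β_∞([-N,N]) = N`, weighted sum on the full box
`= ∑_{n ≤ N} Λ(n)Λ(n+h)`): apply the conjecture at `(d,t,L) = (1,2,3)` to `(n, n+h)` on `K = [-N,N]`.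
[cite: GreenTao2010, Conj. 1.2 and Example 1] -/
theorem pairAsymptotic_of_ghl : ∀ h : ℕ, 1 ≤ h → _root_.GeneralizedHardyLittlewood →
    (fun N : ℕ => ∑ n ∈ Finset.Icc 1 N, Λ n * Λ (n + h) -
      singularSeries ({0, (h : ℤ)} : Finset ℤ) * N) =o[Filter.atTop] fun N : ℕ => (N : ℝ) := by
  intro h hh hG
  have hh0 : h ≠ 0 := by omega
  rw [Asymptotics.isLittleO_iff]
  intro c hc
  obtain ⟨N₀, hN₀⟩ := hG 1 2 3 le_rfl (by norm_num) c hc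
  rw [Filter.eventually_atTop]
  refine ⟨max N₀ h, fun N hN => ?_⟩
  have hNN₀ : N₀ ≤ N := le_of_max_le_left hN
  have hhN : h ≤ N := le_of_max_le_right hN
  have hNpos : 0 < N := lt_of_lt_of_le (by omega) hhN
  have hGN := hN₀ N hNN₀ (shiftPairSystem (h : ℤ))
    (isNondegenerateSystem_shiftPairSystem (by exact_mod_cast hh0))
    (affLinSize_shiftPairSystem_le hNpos hhN) (realBox 1 N) (convex_Icc _ _) subset_rfl
  rw [vonMangoldtSum_shiftPairSystem, archFactor_shiftPairSystem,
    ← singularSeries_pair_eq_singularProduct hh0, pow_one] at hGN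
  rw [Real.norm_eq_abs, Real.norm_eq_abs, Nat.abs_cast, mul_comm (singularSeries _) (N : ℝ)]
  exact hGN

/-- The crux JOINED with the routes' target is the summit conjunct: `PairsToGHL ∧ PairsHL ↔ GHL`
(the direction `GHL → PairsHL` is `pairAsymptotic_of_ghl`, stated shift by shift so that it does not
pose as a proof of the item `PairsHL`). [folklore] -/
theorem pairsToGHL_and_pairsHL_iff_ghl :
    (LiouvilleShiftedTables.PairsToGHL ∧ LiouvilleShiftedTables.PairsHL) ↔
      _root_.GeneralizedHardyLittlewood :=
  ⟨fun h => h.1 h.2, fun h => ⟨fun _ => h, fun k hk => pairAsymptotic_of_ghl k hk h⟩⟩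

/-! ## §8 Toy certificate for finding 5(a): pair data do not determine triple data -/

/-- Two nonnegative weights on `ℤ/12` (values in `{1, 3}`). [folklore] -/
def wLo : List ℤ := [3, 3, 1, 3, 3, 1, 3, 3, 1, 1, 1, 1]

/-- See `wLo`. [folklore] -/
def wHi : List ℤ := [3, 3, 3, 3, 1, 1, 3, 1, 1, 3, 1, 1]

/-- Cyclic evaluation of a length-12 list. [folklore] -/
def cyc (l : List ℤ) (n : ℕ) : ℤ := l.getD (n % 12) 0

/-- `∑_{n mod 12} w(n) w(n+h)`. [folklore] -/
def pairCorr (l : List ℤ) (h : ℕ) : ℤ := ((List.range 12).map fun n => cyc l n * cyc l (n + h)).sum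

/-- `∑_{n mod 12} w(n) w(n+1) w(n+2)`. [folklore] -/
def tripleCorr (l : List ℤ) : ℤ :=
  ((List.range 12).map fun n => cyc l n * cyc l (n + 1) * cyc l (n + 2)).sum

/-- TOY (decidable) for finding 5(a): `wLo`, `wHi ≥ 0` on `ℤ/12` have the SAME mass and the SAME
pair correlation at EVERY shift, yet DIFFERENT triple correlations `∑ w(n)w(n+1)w(n+2)` (`80` vs
`96`; found by exhaustive search over `±1`-sequences of length 12, `w = 2 + s`). So no argument that
consumes only mass + all pair correlations of a nonnegative weight — which is all that `PairsHL`-type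
information provides about `Λ` — can output a 3-point count; a proof of `PairsToGHL` must use
arithmetic of `Λ` beyond its pair statistics. (The honest infinite version — a weight on `ℕ` with
the Hardy–Littlewood pair asymptotics for every shift but a biased triple correlation, via block
perturbations `(a_k, b_k, a_k b_k)` of a Cramér–Granville weight — is sketched in the seat's NOTES.md
and not formalised.) [folklore] -/
theorem toy_pairs_do_not_determine_triples :
    (∀ n < 12, 0 ≤ cyc wLo n ∧ 0 ≤ cyc wHi n) ∧
    ((List.range 12).map (cyc wLo)).sum = ((List.range 12).map (cyc wHi)).sum ∧
    (∀ h < 12, pairCorr wLo h = pairCorr wHi h) ∧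
    tripleCorr wLo = 80 ∧ tripleCorr wHi = 96 := by
  decide

end

end Summit.Parity.GeneralizedHardyLittlewood.Cruxes.PairsToGHL.Disproof
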